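import Literature.Topology.PlaneTopology.Schoenflies
import Literature.Probability.RandomPlanarGeometry.ImageUnivalent
import HarnessLib

/-!
# The Schoenflies theorem for `2`-cells: embeddings of a closed Jordan domain extend to `ℂ`

Topic: Topology / PlaneTopology.  For a Jordan domain `D` (a bounded planar domain bounded by
a Jordan curve, `Literature.Probability.RandomPlanarGeometry.JordanDomain`) and a map
`f : ℂ → ℂ` continuous and injective on `closure D` — a topological embedding of the closed
`2`-cell `closure D` — we prove

* `JordanDomain.exists_homeomorph_eqOn_closure`: **`f` extends to a homeomorphism of `ℂ` onto
  itself**, which moreover maps `D` onto `f(D)` and `ℂ ∖ closure D` onto `ℂ ∖ f(closure D)`.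

Proof.  The image `f(D)` is again a Jordan domain `D'` with frontier `f(∂D)` and closure
`f(closure D)` (`JordanDomain.image`, `ImageUnivalent.lean`: invariance of domain and
Carathéodory's remark, Pommerenke (1992), Thm. 2.6 (i) ⇒ (ii)).  By the Schoenflies theorem of
the tree in the form keeping track of the interiors
(`JordanDomain.exists_homeomorph_eqOn_frontier`, Pommerenke (1992), §2.3 Cor. 2.9; Bing (1983),
§III.6 Thms. III.6.B–C) the boundary correspondence `f : ∂D → ∂D'` extends to a homeomorphism
`h` of `ℂ` with `h(D) = D'` and `h(ℂ ∖ D̄) = ℂ ∖ D̄'`.  The map equal to `f` on `D̄` and to `h`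
off `D̄` is then continuous (the two agree on `∂D̄ ⊆ ∂D`), bijective (`f(D̄) = D̄'`,
`h(ℂ ∖ D̄) = ℂ ∖ D̄'`) and proper, hence a homeomorphism.  This is the classical consequence of
the Schoenflies theorem that a homeomorphism between closed `2`-cells in the plane extends to
the plane (Bing (1983), §III.6; Moise (1977), Ch. 10, Thm. 4); it is the form in which
Schramm–Smirnov (2011) use "the Riemann map onto `ℂ̂ ∖ [Q₀]`" to extend a quad `Q₀` beyond its
square (proof of Lemma 5.1), see
`Literature/Probability/Percolation/QuadCrossingSpaceProofs.lean`.

## References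

* R. H. Bing, *The Geometric Topology of 3-Manifolds*, AMS (1983), §III.6, Thms. III.6.B–C.
  [Bing1983]
* Ch. Pommerenke, *Boundary Behaviour of Conformal Maps* (1992), Thm. 2.6, §2.3 Cor. 2.9.
  [PommerenkeBBCM1992]
* O. Schramm, S. Smirnov, *On the scaling limits of planar percolation*, Ann. Probab. 39 (2011),
  proof of Lemma 5.1. [SchrammSmirnov2011]
-/

noncomputable section

namespace Literature.Topology.PlaneTopology

open Set Metric Filter Bornology Function _root_.Topology
open Literature.Probability.RandomPlanarGeometry

/-- **The Schoenflies theorem for `2`-cells.** A map `f` continuous and injective on the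
closure of a Jordan domain `D` extends to a homeomorphism `H` of `ℂ` onto itself; `H` agrees
with `f` on `closure D`, so it maps `D` onto `f(D)`, `closure D` onto `f(closure D)` and
`ℂ ∖ closure D` onto `ℂ ∖ f(closure D)`.  (Bing (1983), §III.6 Thm. III.6.C with Thm. III.6.B:
the Schoenflies homeomorphism of the boundary curves, `JordanDomain.exists_homeomorph_eqOn_frontier`,
glued with `f` on the closed cell.) [cite: Bing1983, §III.6 Thm. III.6.C (p. 31)] -/
theorem _root_.Literature.Probability.RandomPlanarGeometry.JordanDomain.exists_homeomorph_eqOn_closure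
    (D : JordanDomain) {f : ℂ → ℂ} (hf : ContinuousOn f (closure D.carrier))
    (hinj : InjOn f (closure D.carrier)) :
    ∃ H : ℂ ≃ₜ ℂ, EqOn H f (closure D.carrier) ∧ H '' (closure D.carrier)ᶜ = (f '' closure D.carrier)ᶜ := by
  classical
  set D' := D.image f hf hinj with hD'
  set S := closure D.carrier with hS
  have hScpt : IsCompact S := D.isBounded.isCompact_closure
  have hfr' : frontier D'.carrier = f '' frontier D.carrier := D.frontier_carrier_image f hf hinj
  have hcl' : closure D'.carrier = f '' S := D.closure_carrier_image f hf hinj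
  -- Schoenflies for the boundary correspondence `f : ∂D → ∂D'`
  obtain ⟨h, hEq, -, -, hext⟩ := D.exists_homeomorph_eqOn_frontier D' (φ := f)
    (hf.mono frontier_subset_closure) (by
      rw [hfr']
      exact (hinj.mono frontier_subset_closure).bijOn_image)
  rw [hcl'] at hext
  -- the glued map
  set Hf : ℂ → ℂ := fun z => if z ∈ S then f z else h z with hHf
  have hHS : ∀ z ∈ S, Hf z = f z := fun z hz => if_pos hz
  have hHS' : ∀ z ∉ S, Hf z = h z := fun z hz => if_neg hz
  have hHc : Continuous Hf := by
    refine continuous_if (fun z hz => (hEq (frontier_closure_subset hz)).symm) ?_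
      h.continuous.continuousOn
    have : closure {z | z ∈ S} = S := closure_closure
    rw [this]
    exact hf
  have hmemK : ∀ z ∈ S, Hf z ∈ f '' S := fun z hz => by
    rw [hHS z hz]
    exact mem_image_of_mem f hz
  have hnotK : ∀ z ∉ S, Hf z ∉ f '' S := fun z hz => by
    rw [hHS' z hz]
    have : h z ∈ h '' Sᶜ := mem_image_of_mem h hz
    rw [hext] at this
    exact this
  have hinjH : Injective Hf := by
    intro z z' hzz'
    by_cases hz : z ∈ S <;> by_cases hz' : z' ∈ S
    · rw [hHS z hz, hHS z' hz'] at hzz'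
      exact hinj hz hz' hzz'
    · exact absurd (hmemK z hz) (hzz' ▸ hnotK z' hz')
    · exact absurd (hmemK z' hz') (hzz'.symm ▸ hnotK z hz)
    · rw [hHS' z hz, hHS' z' hz'] at hzz'
      exact h.injective hzz'
  have hsurjH : Surjective Hf := by
    intro w
    by_cases hw : w ∈ f '' S
    · obtain ⟨z, hz, rfl⟩ := hw
      exact ⟨z, hHS z hz⟩
    · have hw' : w ∈ h '' Sᶜ := by rw [hext]; exact hw
      obtain ⟨z, hz, rfl⟩ := hw'
      exact ⟨z, hHS' z hz⟩
  have htend : Tendsto Hf (cocompact ℂ) (cocompact ℂ) := by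
    refine h.isClosedEmbedding.tendsto_cocompact.congr' ?_
    filter_upwards [hScpt.compl_mem_cocompact] with z hz
    exact (hHS' z hz).symm
  have hHomeo : IsHomeomorph Hf :=
    isHomeomorph_iff_continuous_isClosedMap_bijective.2 ⟨hHc,
      (isProperMap_iff_tendsto_cocompact.2 ⟨hHc, htend⟩).isClosedMap, hinjH, hsurjH⟩
  refine ⟨IsHomeomorph.homeomorph Hf hHomeo, fun z hz => hHS z hz, ?_⟩
  show Hf '' Sᶜ = (f '' S)ᶜ
  rw [← hext]
  exact image_congr fun z hz => hHS' z hz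

/-- The extension maps the open domain onto `f(D)`. [folklore] -/
theorem _root_.Literature.Probability.RandomPlanarGeometry.JordanDomain.exists_homeomorph_eqOn_closure'
    (D : JordanDomain) {f : ℂ → ℂ} (hf : ContinuousOn f (closure D.carrier))
    (hinj : InjOn f (closure D.carrier)) :
    ∃ H : ℂ ≃ₜ ℂ, EqOn H f (closure D.carrier) ∧ H '' D.carrier = f '' D.carrier ∧
      H '' closure D.carrier = f '' closure D.carrier ∧
      H '' (closure D.carrier)ᶜ = (f '' closure D.carrier)ᶜ := by
  obtain ⟨H, hH, hext⟩ := D.exists_homeomorph_eqOn_closure hf hinj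
  exact ⟨H, hH, (hH.mono subset_closure).image_eq, hH.image_eq, hext⟩

end Literature.Topology.PlaneTopology
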